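import Literature.AlgebraicGeometry.AbelianSchemes.AbelianSchemeLDeltaLocusOfPolarization
import HarnessLib

/-!
# Normalisation commutes with base change: `(L₀ ⊗ π^*(ε^*L₀)^∨)|_{A_{S'}} ≅ L₀|_{A_{S'}} ⊗ π'^*(ε'^*(L₀|_{A_{S'}}))^∨`
# ([MumfordFogartyKirwan1994] Ch. 6 §2 p. 121 «rigidified along the identity section»; Ch. 7 §2 Prop. 7.3 step (V) «`L′₄ = L₄ ⊗ π^*(ε^*L₄)⁻¹`»)

Layer `Literature/AlgebraicGeometry/AbelianSchemes`, namespace `Literature.AlgebraicGeometry.AbelianSchemes.AbelianSchemeOver`.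
THEOREMS ONLY (no definition, no named fact, no instance, no notation, no `sorry`).  Cell `hodgecm-mathlib` (D-0151), F-DAG row
F-6, cut of B-p02 (g14) 2026-08-30T09:57:11Z for the capstone FILE 3 `MFKSubfunctorOfHilbIntrinsic` (both directions of the intrinsic
clause move MFK's normalised sheaf `L′ = L₀ ⊗ π^*(ε^*L₀)^∨` across a base change); author B-p17 (g13).  HC_CM is proved only modulo
the 7 printed citations until rung 0 closes; nothing here is about HC.

For an abelian scheme `A/S`, `g : S' ⟶ S`, `A' = A.baseChange g` (`pr : A' → A`, `π' : A' → S'`, identity section `ε'` with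
`ε' ≫ pr = g ≫ ε` — ★ `unitSection_baseChange_comp_fst`) and a rank-one `M` on `A`:
* §1 **`nonempty_pullback_normalised_iso_normalised_pullback`** — `pr^*(M ⊗ π^*(ε^*M)^∨) ≅ pr^*M ⊗ π'^*(ε'^*(pr^*M))^∨`: both sides
  are rank one and have the same class in `Ȟ¹(A', 𝒪^×)` since `pr ≫ π ≫ ε = π' ≫ ε' ≫ pr` (`pullback.condition` + the identity-section
  compatibility), ★ `nonempty_iso_iff_detClass_eq`.
* §2 **`nonempty_pullback_whiskerLeft_mumfordBundle_iso_of_nonempty_iso`** — the Mumford bundles of isomorphic rank-one modules agree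
  after any pull-back `(A ◁ a)^*` (★ `nonempty_mumfordBundle_iso_of_nonempty_iso` + functoriality), so the classification letter
  «`(A ◁ (a ≫ lam))^*𝒫 ≅ (A ◁ a)^*Λ(M)`» of ★ α-2′ / ★ (γ) moves along `M ≅ M′`: **`forall_nonempty_classify_iff_of_nonempty_iso`**.

## References
* [MumfordFogartyKirwan1994] D. Mumford, J. Fogarty, F. Kirwan, *Geometric Invariant Theory*, 3rd ed. (1994), Ch. 6 §2 (p. 121),
  Definition 6.2 (p. 120); Ch. 7 §2 Proposition 7.3 (pp. 132–134).
* [Hartshorne1977] R. Hartshorne, *Algebraic Geometry* (1977), II Ex. 6.8, III Ex. 4.5.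
-/

-- `Scheme.Modules` / `SheafOfModules` are not reducible (as in Mathlib's `AlgebraicGeometry/Modules/Sheaf.lean`).
set_option backward.isDefEq.respectTransparency false

noncomputable section

open CategoryTheory CategoryTheory.Limits AlgebraicGeometry MonoidalCategory CartesianMonoidalCategory
open scoped MonObj

universe u

namespace Literature.AlgebraicGeometry.AbelianSchemes

open Literature.AlgebraicGeometry.Motives Literature.AlgebraicGeometry.Modules
  Literature.AlgebraicGeometry.AbelianVarieties

namespace AbelianSchemeOver

variable {S S' : Scheme.{u}} (A : AbelianSchemeOver S) (g : S' ⟶ S) {M M' : A.left.Modules} (hM : HasRank M 1)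
  (hM' : HasRank M' 1)

/-! ## §1 Normalisation commutes with base change -/

include hM in
/-- **`pr^*(M ⊗ π^*(ε^*M)^∨) ≅ pr^*M ⊗ π'^*(ε'^*(pr^*M))^∨`** on `A' = A ×_S S'`: MFK's normalised sheaf `L′ = L ⊗ π^*(ε^*L)⁻¹`
([MumfordFogartyKirwan1994] Ch. 7 §2 Prop. 7.3 step (V); Ch. 6 §2 p. 121) of a rank-one `M` base-changes to the normalised sheaf of
`M|_{A'}`.  In `Ȟ¹(A', 𝒪^×)` both sides are `pr^*[M] · (pr^*π^*ε^*[M])⁻¹ = pr^*[M] · (π'^*ε'^*pr^*[M])⁻¹` because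
`pr ≫ π ≫ ε = π' ≫ g ≫ ε = π' ≫ ε' ≫ pr` (`pullback.condition`, ★ `unitSection_baseChange_comp_fst`); rank-one modules with the same
class are isomorphic (★ `nonempty_iso_iff_detClass_eq`). [cite: MumfordFogartyKirwan1994, Ch. 6 §2 (p. 121)]
[cite: MumfordFogartyKirwan1994, Ch. 7 §2 Proposition 7.3 (pp. 132–134)] [cite: Hartshorne1977, III Ex. 4.5] -/
theorem nonempty_pullback_normalised_iso_normalised_pullback :
    Nonempty ((Scheme.Modules.pullback (pullback.fst A.X.hom g)).obj
        (tensorObj M ((Scheme.Modules.pullback A.X.hom).obj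
          (Modules.dual ((Scheme.Modules.pullback A.unitSection).obj M)))) ≅
      tensorObj ((Scheme.Modules.pullback (pullback.fst A.X.hom g)).obj M)
        ((Scheme.Modules.pullback (A.baseChange g).X.hom).obj
          (Modules.dual ((Scheme.Modules.pullback (A.baseChange g).unitSection).obj
            ((Scheme.Modules.pullback (pullback.fst A.X.hom g)).obj M))))) := by
  -- ranks
  have hεM : HasRank ((Scheme.Modules.pullback A.unitSection).obj M) 1 := hasRank_pullback _ hM
  have hQd : HasRank (Modules.dual ((Scheme.Modules.pullback A.unitSection).obj M)) 1 := hasRank_dual hεM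
  have hQ : HasRank ((Scheme.Modules.pullback A.X.hom).obj
      (Modules.dual ((Scheme.Modules.pullback A.unitSection).obj M))) 1 := hasRank_pullback _ hQd
  have hL : HasRank (tensorObj M ((Scheme.Modules.pullback A.X.hom).obj
      (Modules.dual ((Scheme.Modules.pullback A.unitSection).obj M)))) 1 := hasRank_tensorObj_one hM hQ
  have hLg : HasRank ((Scheme.Modules.pullback (X := (A.baseChange g).X.left) (pullback.fst A.X.hom g)).obj
      (tensorObj M ((Scheme.Modules.pullback A.X.hom).obj
        (Modules.dual ((Scheme.Modules.pullback A.unitSection).obj M))))) 1 := hasRank_pullback _ hL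
  have hMg : HasRank ((Scheme.Modules.pullback (X := (A.baseChange g).X.left) (pullback.fst A.X.hom g)).obj M) 1 :=
    hasRank_pullback _ hM
  have hεMg : HasRank ((Scheme.Modules.pullback (A.baseChange g).unitSection).obj
      ((Scheme.Modules.pullback (X := (A.baseChange g).X.left) (pullback.fst A.X.hom g)).obj M)) 1 :=
    hasRank_pullback _ hMg
  have hQgd : HasRank (Modules.dual ((Scheme.Modules.pullback (A.baseChange g).unitSection).obj
      ((Scheme.Modules.pullback (X := (A.baseChange g).X.left) (pullback.fst A.X.hom g)).obj M))) 1 := hasRank_dual hεMg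
  have hQg : HasRank ((Scheme.Modules.pullback (A.baseChange g).X.hom).obj
      (Modules.dual ((Scheme.Modules.pullback (A.baseChange g).unitSection).obj
        ((Scheme.Modules.pullback (X := (A.baseChange g).X.left) (pullback.fst A.X.hom g)).obj M)))) 1 :=
    hasRank_pullback _ hQgd
  have hR : HasRank (tensorObj ((Scheme.Modules.pullback (X := (A.baseChange g).X.left) (pullback.fst A.X.hom g)).obj M)
      ((Scheme.Modules.pullback (A.baseChange g).X.hom).obj
        (Modules.dual ((Scheme.Modules.pullback (A.baseChange g).unitSection).obj
          ((Scheme.Modules.pullback (X := (A.baseChange g).X.left) (pullback.fst A.X.hom g)).obj M))))) 1 :=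
    hasRank_tensorObj_one hMg hQg
  let fM := HasRank.isFiniteLocallyFree' hM
  let fεM := HasRank.isFiniteLocallyFree' hεM
  let fQd := HasRank.isFiniteLocallyFree' hQd
  let fQ := HasRank.isFiniteLocallyFree' hQ
  let fL := HasRank.isFiniteLocallyFree' hL
  let fLg := HasRank.isFiniteLocallyFree' hLg
  let fMg := HasRank.isFiniteLocallyFree' hMg
  let fεMg := HasRank.isFiniteLocallyFree' hεMg
  let fQgd := HasRank.isFiniteLocallyFree' hQgd
  let fQg := HasRank.isFiniteLocallyFree' hQg
  let fR := HasRank.isFiniteLocallyFree' hR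
  -- the class of `pr^*M`
  have hMgc : detClass fMg = CechPic.pullback (X := (A.baseChange g).X.left) (pullback.fst A.X.hom g) (detClass fM) :=
    (detClass_eq_of_iso (Iso.refl _) fMg (fM.pullback _)).trans (detClass_pullback _ fM)
  -- the class of the left side
  have h1 : detClass fLg = CechPic.pullback (X := (A.baseChange g).X.left) (pullback.fst A.X.hom g) (detClass fM) *
      (CechPic.pullback (X := (A.baseChange g).X.left) (pullback.fst A.X.hom g)
        (CechPic.pullback A.X.hom (CechPic.pullback A.unitSection (detClass fM))))⁻¹ := by
    rw [(detClass_eq_of_iso (Iso.refl _) fLg (fL.pullback _)).trans (detClass_pullback _ fL),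
      detClass_tensorObj_of_hasRank_one hM hQ fM fQ fL,
      (detClass_eq_of_iso (Iso.refl _) fQ (fQd.pullback A.X.hom)).trans (detClass_pullback A.X.hom fQd),
      detClass_dual' fεM fQd, (detClass_eq_of_iso (Iso.refl _) fεM (fM.pullback A.unitSection)).trans
        (detClass_pullback A.unitSection fM), map_mul, map_inv, map_inv]
  -- the class of the right side
  have h2 : detClass fR = CechPic.pullback (X := (A.baseChange g).X.left) (pullback.fst A.X.hom g) (detClass fM) *
      (CechPic.pullback (A.baseChange g).X.hom (CechPic.pullback (A.baseChange g).unitSection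
        (CechPic.pullback (X := (A.baseChange g).X.left) (pullback.fst A.X.hom g) (detClass fM))))⁻¹ := by
    rw [detClass_tensorObj_of_hasRank_one hMg hQg fMg fQg fR,
      (detClass_eq_of_iso (Iso.refl _) fQg (fQgd.pullback (A.baseChange g).X.hom)).trans
        (detClass_pullback (A.baseChange g).X.hom fQgd),
      detClass_dual' fεMg fQgd, (detClass_eq_of_iso (Iso.refl _) fεMg (fMg.pullback (A.baseChange g).unitSection)).trans
        (detClass_pullback (A.baseChange g).unitSection fMg), hMgc, map_inv]
  -- the two composite morphisms `A' → A` along which `[M]` is pulled back agree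
  have hmor : ((pullback.fst A.X.hom g : (A.baseChange g).X.left ⟶ A.X.left) ≫ A.X.hom) ≫ A.unitSection =
      ((A.baseChange g).X.hom ≫ (A.baseChange g).unitSection) ≫ (pullback.fst A.X.hom g : (A.baseChange g).X.left ⟶ A.X.left) :=
    (Category.assoc _ _ _).trans (((congrArg (· ≫ A.unitSection) (pullback.condition (f := A.X.hom) (g := g))).trans
      (Category.assoc _ _ _)).trans ((congrArg ((A.baseChange g).X.hom ≫ ·) (A.unitSection_baseChange_comp_fst g)).symm.trans
        (Category.assoc _ _ _).symm))
  have key : CechPic.pullback (X := (A.baseChange g).X.left) (pullback.fst A.X.hom g)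
        (CechPic.pullback A.X.hom (CechPic.pullback A.unitSection (detClass fM))) =
      CechPic.pullback (A.baseChange g).X.hom (CechPic.pullback (A.baseChange g).unitSection
        (CechPic.pullback (X := (A.baseChange g).X.left) (pullback.fst A.X.hom g) (detClass fM))) :=
    calc CechPic.pullback (X := (A.baseChange g).X.left) (pullback.fst A.X.hom g) (CechPic.pullback A.X.hom (CechPic.pullback A.unitSection (detClass fM)))
        = CechPic.pullback (((pullback.fst A.X.hom g : (A.baseChange g).X.left ⟶ A.X.left) ≫ A.X.hom) ≫ A.unitSection) (detClass fM) :=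
          ((CechPic.pullback_comp ((pullback.fst A.X.hom g : (A.baseChange g).X.left ⟶ A.X.left) ≫ A.X.hom) A.unitSection _).trans
            (CechPic.pullback_comp (pullback.fst A.X.hom g : (A.baseChange g).X.left ⟶ A.X.left) A.X.hom _)).symm
      _ = CechPic.pullback (((A.baseChange g).X.hom ≫ (A.baseChange g).unitSection) ≫
            (pullback.fst A.X.hom g : (A.baseChange g).X.left ⟶ A.X.left)) (detClass fM) :=
          congrArg (CechPic.pullback · (detClass fM)) hmor
      _ = CechPic.pullback (A.baseChange g).X.hom (CechPic.pullback (A.baseChange g).unitSection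
            (CechPic.pullback (X := (A.baseChange g).X.left) (pullback.fst A.X.hom g) (detClass fM))) :=
          (CechPic.pullback_comp ((A.baseChange g).X.hom ≫ (A.baseChange g).unitSection) (pullback.fst A.X.hom g : (A.baseChange g).X.left ⟶ A.X.left) _).trans
            (CechPic.pullback_comp (A.baseChange g).X.hom (A.baseChange g).unitSection _)
  refine (nonempty_iso_iff_detClass_eq hLg hR fLg fR).2 ?_
  rw [h1, h2, key]

/-! ## §2 The Mumford-bundle classification letter moves along an isomorphism of rank-one modules -/

include hM hM' in
/-- **`(A ◁ a)^*Λ(M) ≅ (A ◁ a)^*Λ(M′)` for `M ≅ M′`** (★ `nonempty_mumfordBundle_iso_of_nonempty_iso`, functoriality of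
pull-back). [cite: MumfordFogartyKirwan1994, Ch. 6 §2 Definition 6.2 (p. 120)] -/
theorem nonempty_pullback_whiskerLeft_mumfordBundle_iso_of_nonempty_iso (h : Nonempty (M ≅ M')) {U : Over S}
    (a : U ⟶ A.X) :
    Nonempty ((Scheme.Modules.pullback (A.X ◁ a).left).obj (A.mumfordBundle M) ≅
      (Scheme.Modules.pullback (A.X ◁ a).left).obj (A.mumfordBundle M')) := by
  obtain ⟨i⟩ := A.nonempty_mumfordBundle_iso_of_nonempty_iso hM hM' h
  exact ⟨(Scheme.Modules.pullback (A.X ◁ a).left).mapIso i⟩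

include hM hM' in
/-- **The classification letter of ★ α-2′ / ★ (γ) («`lam` classifies the Mumford family of `M`», whisker spelling) is invariant
under `M ≅ M′`**: for a dual pair `D` and `lam : A → Â`, `(∀ a, (A ◁ (a ≫ lam))^*𝒫 ≅ (A ◁ a)^*Λ(M)) ↔ (∀ a, … ≅ (A ◁ a)^*Λ(M′))`.
[cite: MumfordFogartyKirwan1994, Ch. 6 §2 Definition 6.2 (p. 120)] [cite: Hartshorne1977, III Ex. 4.5] -/
theorem forall_nonempty_classify_iff_of_nonempty_iso (D : A.DualPair) (lam : A.X ⟶ D.hat.X) (h : Nonempty (M ≅ M')) :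
    (∀ ⦃U : Over S⦄ (a : U ⟶ A.X),
        Nonempty ((Scheme.Modules.pullback (A.X ◁ (a ≫ lam)).left).obj D.P ≅
          (Scheme.Modules.pullback (A.X ◁ a).left).obj (A.mumfordBundle M))) ↔
      ∀ ⦃U : Over S⦄ (a : U ⟶ A.X),
        Nonempty ((Scheme.Modules.pullback (A.X ◁ (a ≫ lam)).left).obj D.P ≅
          (Scheme.Modules.pullback (A.X ◁ a).left).obj (A.mumfordBundle M')) := by
  constructor
  · intro H U a
    obtain ⟨e⟩ := H a
    obtain ⟨i⟩ := A.nonempty_pullback_whiskerLeft_mumfordBundle_iso_of_nonempty_iso hM hM' h a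
    exact ⟨e ≪≫ i⟩
  · intro H U a
    obtain ⟨e⟩ := H a
    obtain ⟨i⟩ := A.nonempty_pullback_whiskerLeft_mumfordBundle_iso_of_nonempty_iso hM hM' h a
    exact ⟨e ≪≫ i.symm⟩

end AbelianSchemeOver

end Literature.AlgebraicGeometry.AbelianSchemes

end
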